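import Summits.QuantumFields.YangMills.Theorems.UnitScaleTiltProp7LemmaHCurvedOfLocalModelsPt
import Summits.QuantumFields.YangMills.Theorems.UnitScaleTiltProp7RowHOfLocalModelRows
import HarnessLib

/-!
# Route `UnitScaleTilt`, crux K1 child «MinimiserStabilityRegPr» (stmt-QuantumFields-19200) — route-R E′, S3 K-form engine, ROW (H) of the R5 door ✓`Prop7ZetaRowOfEngineRows`:
# «ROW (H) KNIT», POINTWISE-RECENTRING EDITION — (H) ⇐ ✓`lemmaH_curved_of_localModels_pt` (routeR-w1 F-H9p₂) + hRes + hDir + hGJ_pt; no sup-type `G`, no data row `hG`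

Cell `ym3-torus` ∕ fleet seat `ym-ust-19200-p1` (gen 16, route-R E′ lead ∕ namer; routeR-w1 g6 LOCATE (J-δV) (d) 2026-08-28 23:16Z «the sup-type `G` must become pointwise» + NAMER
WORD 4 (4)).  THEOREMS ONLY (0 `def`, 0 `sorry`); `--supports stmt-QuantumFields-19200`, count-neutral.  YM₃ on T³ is a ladder rung (R3), not the Clay problem; nothing here
claims the stub, the crux, d = 4 or the mass gap; row (H) is NOT closed by this file — hRes ∕ hDir ∕ hGJ_pt are DISPLAYED.

WHY.  ✓`Prop7RowHOfLocalModelRows.rowH_of_localModelRows` knits row (H) from ✓p666125, whose interpolation-consistency group is priced through a SUP-type data row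
`‖Ψ_y(z) − Z_μ(z)‖ ≤ G_y` (one number per block).  A sup of junction-loop commutators is not bookable by any sum-type hKg′ row and `max ≤ sum` loses `ℓ^d` (routeR-w1's LOCATE
(J-δV) (d)).  ✓p677940 `Prop7LemmaHCurvedOfLocalModelsPt.lemmaH_curved_of_localModels_pt` re-prices that group POINTWISE: `3·(d·(24∕ℓ)²)²·Σ_yΣ_z[N y z]Σ_μ‖Ψ_y(z) − Z_μ(z)‖²`, no `G`,
no `hG`.  This file is the corresponding knit: (H) ⇐ that door + the three displayed rows hRes, hDir (VERBATIM as before) and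
hGJ_pt `2·3·(d·(24∕ℓ)²)²·Σ_yΣ_z[N]Σ_μ‖Ψ_y(z) − Z_μ(z)‖² ≤ C_H·ℓ⁻¹·δV + ζ_G·K + θ_G·e·ℓ⁻²·M` (the junction; inhabitant route: routeR-w1's F-H9q with `Z := Ψ̄_{B(z)}`, output
`C(d)·Σ_c δ^S_c` + (Kg′-J) junction loops + (Kg″) `W̄ ↔ S_c` averaging-defect commutators).

WHAT IS PROVED (ns `…Theorems.Prop7RowHOfLocalModelRowsPt`): ★★★ `rowH_of_localModelRows_pt`.
HONEST SCOPE.  Bookkeeping over one landed theorem; the three rows are DISPLAYED, not proved; no constant of Bałaban's is asserted.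

References: T. Bałaban, CMP 99 (1985) 389–434 [Balaban1985BackgroundPropagators] ((3.3)–(3.4) pp.390–391, (3.8) p.392, Thm 3.11 p.416); CMP 95 (1984) 17–40
[Balaban1984PropagatorsI] ((1.18) p.20, (1.29)–(1.31) p.23, Prop. 1.1 (1.90) p.33); CMP 102 (1985) 277–309 [Balaban1985Variational] (Prop. 7 p.299, (141)–(143)).
-/

set_option autoImplicit false

noncomputable section

open scoped BigOperators Matrix.Norms.L2Operator Matrix

namespace Summit.QuantumFields.YangMills.Theorems.Prop7RowHOfLocalModelRowsPt

open Literature.MathematicalPhysics.QuantumFieldTheory.Balaban1983to89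
open Literature.MathematicalPhysics.QuantumFieldTheory.Balaban1983to89.T3ContinuumYM3Torus
open B9Eq39Adjoint (R covD covDstar divB)
open B9TorusCalculus (torusT)
open B10Eq27TorusAxialLog (unitsField toUField)
open B5Eq118OneStroke (iterBlockOf)
open B15DeterminingSets (embIter)
open Summit.QuantumFields.YangMills.Theorems.Prop7LemmaHCurvedOfLocalModelsPt (lemmaH_curved_of_localModels_pt)

set_option maxHeartbeats 800000 in
/-- ★★★ **ROW (H) OF THE ENGINE DOOR ⇐ LEMMA-H-CURVED (POINTWISE RECENTRING) + hRes + hDir + hGJ_pt.**  Run `K`, height `n` (`K − n ≤ m + K`, `ℓ = L^(K−n) ≥ 2`), `SU(2)`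
background `W`, a site field `ψ` with `Δ_W(Δ_Wψ) = 0` off the `(K−n)`-centres, reals `K M δV e C_H ζ_R θ_R ζ_D θ_D ζ_G θ_G`.  IF there are local models `Ψ_y` interpolating `ψ`
at the centres and a recentring field `Z` with the three displayed rows hRes, hDir, hGJ_pt, THEN
`Σ_x|D*_W D_Wψ(x)|²_HS ≤ C_H·ℓ⁻¹·δV + (ζ_R + ζ_D + ζ_G)·K + (θ_R + θ_D + θ_G)·e·ℓ⁻²·M` — row (H) of ✓`Prop7ZetaRowOfEngineRows.zetaRow_of_engineRows`.
[cite: Balaban1985BackgroundPropagators, (3.3)-(3.4) pp.390-391, Thm 3.11 p.416; Balaban1984PropagatorsI, Prop. 1.1 (1.90) p.33; Balaban1985Variational, Prop. 7 p.299] -/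
theorem rowH_of_localModelRows_pt (F : T3Family) (K n : ℕ) (hk : K - n ≤ (F.P K).m + (F.P K).K) (hℓ2 : 2 ≤ (F.P K).L ^ (K - n))
    (W : GaugeField (F.P K) 0 (Matrix.specialUnitaryGroup (Fin 2) ℂ)) (ψ : Site (F.P K) 0 → Matrix (Fin 2) (Fin 2) ℂ)
    (hψ : ∀ x : Site (F.P K) 0, x ∉ Set.range (embIter (K - n)) →
      divB (torusT (F.P K) 0) (fun κ z => unitsField (toUField W) ⟨z, κ⟩) (fun κ y => covD (torusT (F.P K) 0) (fun κ z => unitsField (toUField W) ⟨z, κ⟩) κ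
        (fun z => divB (torusT (F.P K) 0) (fun κ z => unitsField (toUField W) ⟨z, κ⟩)
          (fun ν w => covD (torusT (F.P K) 0) (fun κ z => unitsField (toUField W) ⟨z, κ⟩) ν ψ w) z) y) x = 0)
    {Kr Mr δV e C_H ζ_R θ_R ζ_D θ_D ζ_G θ_G : ℝ}
    (hrows : ∃ (Ψ : Site (F.P K) (K - n) → Site (F.P K) 0 → Matrix (Fin 2) (Fin 2) ℂ)
        (Z : Fin (F.P K).d → Site (F.P K) 0 → Matrix (Fin 2) (Fin 2) ℂ),
      (∀ y, Ψ y (embIter (K - n) y) = ψ (embIter (K - n) y)) ∧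
      -- hRes: the Laplacian group of the local models
      6 * (∑ y : Site (F.P K) (K - n), ∑ z : Site (F.P K) 0,
            (if (∀ ν : Fin (F.P K).d,
                (y ν = (iterBlockOf (K - n) (fun κ => z κ - (((((F.P K).L ^ (K - n) - 1) / 2 : ℕ)) : ZMod ((F.P K).sitesPerDir 0)))) ν - 1
                ∨ y ν = (iterBlockOf (K - n) (fun κ => z κ - (((((F.P K).L ^ (K - n) - 1) / 2 : ℕ)) : ZMod ((F.P K).sitesPerDir 0)))) ν
                ∨ y ν = (iterBlockOf (K - n) (fun κ => z κ - (((((F.P K).L ^ (K - n) - 1) / 2 : ℕ)) : ZMod ((F.P K).sitesPerDir 0)))) ν + 1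
                ∨ y ν = (iterBlockOf (K - n) (fun κ => z κ - (((((F.P K).L ^ (K - n) - 1) / 2 : ℕ)) : ZMod ((F.P K).sitesPerDir 0)))) ν + 2))
              then ‖divB (torusT (F.P K) 0) (fun κ z => unitsField (toUField W) ⟨z, κ⟩)
                (fun μ => covD (torusT (F.P K) 0) (fun κ z => unitsField (toUField W) ⟨z, κ⟩) μ (Ψ y)) z‖ ^ 2 else 0))
        ≤ ζ_R * Kr + θ_R * e * (((F.L : ℝ) ^ (K - n)) ^ 2)⁻¹ * Mr ∧
      -- hDir: the supported covariant Dirichlet group of the local models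
      2 * (3 * (2 * ((F.P K).d : ℝ) * (6 / ((((F.P K).L ^ (K - n) : ℕ) : ℝ)))) * (3 / ((((F.P K).L ^ (K - n) : ℕ) : ℝ))))
          * (∑ y : Site (F.P K) (K - n), ∑ z : Site (F.P K) 0,
              (if (∀ ν : Fin (F.P K).d,
                  (y ν = (iterBlockOf (K - n) (fun κ => z κ - (((((F.P K).L ^ (K - n) - 1) / 2 : ℕ)) : ZMod ((F.P K).sitesPerDir 0)))) ν - 1
                  ∨ y ν = (iterBlockOf (K - n) (fun κ => z κ - (((((F.P K).L ^ (K - n) - 1) / 2 : ℕ)) : ZMod ((F.P K).sitesPerDir 0)))) ν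
                  ∨ y ν = (iterBlockOf (K - n) (fun κ => z κ - (((((F.P K).L ^ (K - n) - 1) / 2 : ℕ)) : ZMod ((F.P K).sitesPerDir 0)))) ν + 1
                  ∨ y ν = (iterBlockOf (K - n) (fun κ => z κ - (((((F.P K).L ^ (K - n) - 1) / 2 : ℕ)) : ZMod ((F.P K).sitesPerDir 0)))) ν + 2))
                then ∑ μ : Fin (F.P K).d,
                  (‖covDstar (torusT (F.P K) 0) (fun κ z => unitsField (toUField W) ⟨z, κ⟩) μ (Ψ y) z‖ ^ 2
                    + ‖covD (torusT (F.P K) 0) (fun κ z => unitsField (toUField W) ⟨z, κ⟩) μ (Ψ y) z‖ ^ 2) else 0))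
        ≤ ζ_D * Kr + θ_D * e * (((F.L : ℝ) ^ (K - n)) ^ 2)⁻¹ * Mr ∧
      -- hGJ_pt: the POINTWISE interpolation-consistency group, booked against `δV` (the junction) and the currencies
      2 * (3 * (((F.P K).d : ℝ) * (24 / ((((F.P K).L ^ (K - n) : ℕ) : ℝ)) ^ 2) ^ 2))
          * (∑ y : Site (F.P K) (K - n), ∑ z : Site (F.P K) 0,
              (if (∀ ν : Fin (F.P K).d,
                  (y ν = (iterBlockOf (K - n) (fun κ => z κ - (((((F.P K).L ^ (K - n) - 1) / 2 : ℕ)) : ZMod ((F.P K).sitesPerDir 0)))) ν - 1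
                  ∨ y ν = (iterBlockOf (K - n) (fun κ => z κ - (((((F.P K).L ^ (K - n) - 1) / 2 : ℕ)) : ZMod ((F.P K).sitesPerDir 0)))) ν
                  ∨ y ν = (iterBlockOf (K - n) (fun κ => z κ - (((((F.P K).L ^ (K - n) - 1) / 2 : ℕ)) : ZMod ((F.P K).sitesPerDir 0)))) ν + 1
                  ∨ y ν = (iterBlockOf (K - n) (fun κ => z κ - (((((F.P K).L ^ (K - n) - 1) / 2 : ℕ)) : ZMod ((F.P K).sitesPerDir 0)))) ν + 2))
                then ∑ μ : Fin (F.P K).d, ‖Ψ y z - Z μ z‖ ^ 2 else 0))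
        ≤ C_H * ((F.L : ℝ) ^ (K - n))⁻¹ * δV + ζ_G * Kr + θ_G * e * (((F.L : ℝ) ^ (K - n)) ^ 2)⁻¹ * Mr) :
    ∑ x : Site (F.P K) 0, ∑ a : Fin 2, ∑ b : Fin 2,
        Complex.normSq ((divB (torusT (F.P K) 0) (fun κ z => unitsField (toUField W) ⟨z, κ⟩)
          (fun κ y => covD (torusT (F.P K) 0) (fun κ z => unitsField (toUField W) ⟨z, κ⟩) κ ψ y) x) a b)
      ≤ C_H * ((F.L : ℝ) ^ (K - n))⁻¹ * δV + (ζ_R + ζ_D + ζ_G) * Kr + (θ_R + θ_D + θ_G) * e * (((F.L : ℝ) ^ (K - n)) ^ 2)⁻¹ * Mr := by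
  obtain ⟨Ψ, Z, hΨ, hRes, hDir, hGJ⟩ := hrows
  have main := lemmaH_curved_of_localModels_pt F K n hk hℓ2 W ψ hψ Ψ hΨ Z
  have hL2 : (2 : ℝ) ≤ (F.L : ℝ) ^ (K - n) := by exact_mod_cast hℓ2.trans_eq (by rfl)
  have hℓ : (0 : ℝ) < (F.L : ℝ) ^ (K - n) := by linarith
  have h1 := le_of_mul_le_mul_left main hℓ
  linarith [h1, hRes, hDir, hGJ]

end Summit.QuantumFields.YangMills.Theorems.Prop7RowHOfLocalModelRowsPt

end
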